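import Literature.MathematicalPhysics.QuantumFieldTheory.Balaban1983to89.Node00.TorusCoverLandau153Print
import Literature.MathematicalPhysics.QuantumFieldTheory.Balaban1983to89.B8Eq138LandauFlatOrthogonal
import Literature.MathematicalPhysics.QuantumFieldTheory.Balaban1983to89.B8Ineq159FlatMaps
import Literature.MathematicalPhysics.QuantumFieldTheory.Balaban1983to89.B8Eq191FlatLettersCubeMember
import Literature.MathematicalPhysics.QuantumFieldTheory.Balaban1983to89.LatticeFieldCalculus

/-!
# NODE 00 — THE (153) TOKEN AT THE RECORD'S TORUS, TEST-FUNCTION FORM: [Balaban1985Variational] (153) ∕ [Balaban1985RegularSpaces] (1.38)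
# «R ∂^{η*}A = 0» read as [Balaban1984PropagatorsII] (2.12) «⟨Δμ, ∂*A⟩ = 0 for every μ ∈ N(Q′)», for the pushed-down potential of the
# torus → `ℤᵈ` twin, in `LatticeFieldCalculus` letters on the torus of record

Cell `pub-ymgap`, width seat `pub-ymgap-dag-n07-w3` generation 2 (HUMAN RULING D-0149 ∕ director-ym №197; DAG node N07 = [15]; cell INBOX CLAIM-1 ∕ INTENT-1 of
2026-08-28).  NEW leaf, PROOF kind (no `def`, no `instance`, no `notation`).  CONSUMED BY NAME, nothing modified: dag-n05-c's `B8Eq138LandauFlatOrthogonal`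
(`pairing_covLap_eq_zero_of_isLandau138`: the multiplier form of (1.38) at `U₀ = 1` implies print's orthogonality form on `ℤᵈ`, `ℂ`-valued), dag-n05-e's
`B8Ineq159FlatMaps` (`isLandau138_map_flat`, `map_covDivB_flat`: the «⊗ identity»), generation 0 of this seat (`Node00.TorusCoverLandau153` ∕ `…Print`: `covLap_one_apply`,
the six-clause push-down `exists_localGauge152_153_window_of_gaugedBoundB8` whose sixth conjunct is the INPUT shape of §4), dag-n07-e's FILES 25 ∕ 34b (`cover_add_e`,
`cover_sub_e`), N05's `B8Eq138LandauZd.IsLandau138` and `B8Eq131Cubes` (`box_subset_cube`, `cubeFam_false_zero`), n05-c's `B8Eq191FlatLettersCubeMember.cubeFam_zero_finite`,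
pub-balaban's `LatticeFieldCalculus` (`laplace`, `diverg`), r15's `cover`.  `--kind proof --supports stmt-QuantumFields-20542 --as helper` (K1⁷; count-neutral).
[15] = [Balaban1985Variational]; [6] = [Balaban1985RegularSpaces]; [B6] = [Balaban1984PropagatorsII]; [4] = [Balaban1985BackgroundPropagators].

WHY.  [15] p. 301: after the local gauge of (152) print records the gauge condition (153) «`R ∂^{η*}A = 0`, where the operator `R` is defined for the sequence
`{Ω″_j}`» — [6] (1.38), `R` = the orthogonal projection onto `ΔN(Q′)` ([6] p. 80; [B6] (2.10)–(2.12) p. 225; [4] (3.25)) — and p. 302 «all the operators in this section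
are taken without any external gauge field configuration (or alternatively with the configuration equal to 1)».  Generation 0 carried (153) for the `ℤᵈ` LIFT `A′` of the
pushed-down torus potential `A` in N05's MULTIPLIER form `IsLandau138 L k η □₀ {Λ′_j} 1 A′` («`Δ^η_1(𝟙_{□₀}·D^{η*}_1A′) = Q′(1)ᵀμ` on `□₀`»).  The S4 consumer at the record
(`pub-ymgap-k0-s1-w1`'s `…K0Stub1FlatHessianRGaugeCoercivityAtRecord`) displays (153) in lit-balaban's V1 letters `RE D c (dsE c a) = 0` on the torus of record, which by
`B6SectAOperatorsV1.RE_eq_zero_iff` is the TEST-FUNCTION form of (2.12): «`⟨Δμ, ∂*a⟩ = 0` for every `μ ∈ N(Q′)`» — `N(Q′)` = the scalar functions vanishing on `Λ₀` with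
vanishing block means on the blocks of `Λ_j` ([B6] (2.7)).  AT THE FLAT BACKGROUND the transpose `Q′(1)ᵀ` is the plain block-mean tower (n05-e
`B8Eq191FlatStencils.QT_flat_apply`; no contour, no transporter), so (153) needs no averaging dictionary — only the block GEOMETRY under the cover.  THIS FILE transports
n05-c's `ℤᵈ` orthogonality identity through the cover: for the pushed-down potential `A` (`A ⟨π x, κ⟩ = A′ x κ` on a cover-injective window `X ⊆ □₀`) and every torus test
function `μ` whose support lifts two steps inside `X`, vanishing on the lift of `Λ₀` and with vanishing `Lʲ`-block sums on the lifted blocks of `Λ_j`, and every continuous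
linear functional `φ` of the fibre (the matrix entries), `Σ_{y} (Δμ)(y)·φ((∂*A)(y)) = 0` with `Δ = LatticeFieldCalculus.laplace η⁻¹`, `∂* = LatticeFieldCalculus.diverg η⁻¹`
— the pairing `⟨Δμ, ∂*a⟩` of `B6SectAOperatorsV1.inner_eq_sum` for `a = Re ∕ Im (φ ∘ A)` (§3, real forms).

CONTENTS.  §1 `pairing_covLap_map_eq_zero_of_isLandau138` (ℤᵈ, any fibre, every `φ`: n05-c ∘ n05-e).  §2 cover transport of the flat stencils: `covLap_one_eq_laplace_cover`,
`covDivB_one_eq_diverg_cover`, `sum_eq_finsum_cover`.  §3 ★★ `sum_laplace_mul_diverg_eq_zero_of_isLandau138_cover` + the real forms `…_re` ∕ `…_im` (real test function,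
real ∕ imaginary part of `φ ∘ A` as a real bond function).  §4 ★ `sum_laplace_mul_diverg_eq_zero_of_window153` (the input is LITERALLY the sixth conjunct of generation 0's
window ∕ cube theorems at a `CubeB8` datum `c`, window `X ⊆ box`).

HONEST FRAMING: kernel bookkeeping — the summation by parts is n05-c's, the ⊗-identity n05-e's, the cover identities follow 34b's pattern; the test function's rows
(support two steps inside the window, zero on the lift of `Λ₀`, zero lifted block sums) are DISPLAYED hypotheses in cover letters — their identification with
`ker (B6SectAOperatorsV1.QpE D)` of a `B6SectADomainsV1.Domains (F.P K)` family is NOT made here; the Dirichlet reading on `□₀` ([4] (3.24)) and the whole-torus reading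
(2.12) agree for these test functions only because their Laplacian stays inside the window — nothing is claimed for test functions touching `∂□̃`; nothing of [15] ∕ [6] ∕
[B6] analysis asserted; [6] Proposition 6 at the member remains the HYPOTHESIS of generation 0's theorems; N07 ∕ N05 ∕ K0⁷ ∕ K1⁷ NOT closed or discharged; counts unmoved
(typed 28∕28 · discharged 5∕27); one finite 𝕋⁴ programme at fixed ε — R4 closes the conditional finite-𝕋⁴ rung `BalabanLadder.UV` only; the YM mass gap (Clay) is NOT
proved by any of this; nothing continuum ∕ ℝ⁴ ∕ infinite volume ∕ OS.  No `sorry`, no `def`, no `instance`, no `notation`.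

EDITION v1.1 (generation 4, 2026-08-28; referee ref-L g6 READ-191 NIT-1): the stray build-time `#print axioms` command after §4 removed; every declaration byte-identical.
The identification of the displayed rows with `ker (QpE D)` of a `Domains (F.P K)` family, named as open in READ-191, is generation 2's later files
`Node00.TorusCoverLandau153InGauge` ∕ `…CubeDomains` ∕ `…RE` (by name, for the datum's own tower `Node00.cubeDomains`).
-/

noncomputable section

namespace Literature.MathematicalPhysics.QuantumFieldTheory.Balaban1983to89.Node00

open scoped Matrix.Norms.L2Operator
open B7Prop1Explicit (e e_apply)
open B8Ineq132 (covDeriv)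
open B8Eq131Cubes (box)
open B8Eq131CubesAdmissible (cubeFam_false_zero)
open B8Eq138LandauZd (covDivB covLap IsLandau138)
open B8Eq138LandauFlatOrthogonal (pairing_covLap_eq_zero_of_isLandau138)
open B8Ineq159FlatMaps (isLandau138_map_flat map_covDivB_flat)
open B8Eq191FlatLettersCubeMember (cubeFam_zero_finite)
open B15Eq112TorusCover (cover)
open B14DomainGeom (Pt)
open LatticeFieldCalculus (laplace diverg)
open Literature.MathematicalPhysics.QuantumLattice (blockSites)

variable {d : ℕ}

/-! ## §1  The orthogonality form of the flat (1.38) for every linear functional of the fibre (`ℤᵈ`; n05-c ∘ n05-e) -/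

section Zd

variable {𝔸 : Type*} [NormedRing 𝔸] [NormedAlgebra ℂ 𝔸] [CompleteSpace 𝔸]

/-- **MULTIPLIER FORM ⇒ ORTHOGONALITY FORM OF THE FLAT LANDAU CONDITION (1.38), FOR EVERY LINEAR FUNCTIONAL OF THE FIBRE**: if `Δ^η_1(𝟙_{Ω₀}·D^{η*}_1A′) =
Q′(1)ᵀμ` on the finite `Ω₀` (`IsLandau138 L m η Ω₀ Λs 1 A′`, `𝔸`-valued `A′`), then for every `φ : 𝔸 →L[ℂ] ℂ` and every gauge test function `λ` of `N(Q′)` — supported in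
`Ω₀`, `= 0` on `Λ₀`, zero `Lʲ`-block sums on the blocks of `Λ_j`, `1 ≤ j ≤ m` — `Σ_x (Δ^η_1λ)(x)·(𝟙_{Ω₀}D^{η*}_1(φ∘A′))(x) = 0`: «R D*A = 0» entrywise (n05-e's ⊗-identity
`isLandau138_map_flat`, then n05-c's `pairing_covLap_eq_zero_of_isLandau138`). [cite: Balaban1985RegularSpaces, (1.38) p.82, (1.29) p.81; Balaban1984PropagatorsII, (2.7) p.224, (2.10)–(2.12) p.225; Balaban1985BackgroundPropagators, (3.24)–(3.25) p.394] -/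
theorem pairing_covLap_map_eq_zero_of_isLandau138 {L m : ℕ} (hL : 1 ≤ L) {η : ℝ} {Ω₀ : Set (B7Prop1Explicit.Site d)} (hΩ : Ω₀.Finite)
    {Λs : ℕ → Set (B7Prop1Explicit.Site d)} {A' : B7Prop1Explicit.Site d → Fin d → 𝔸}
    (h : IsLandau138 L m η Ω₀ Λs (1 : B7Prop1Explicit.Site d → Fin d → 𝔸ˣ) A') (φ : 𝔸 →L[ℂ] ℂ)
    {lam : B7Prop1Explicit.Site d → ℂ} (hsupp : ∀ x, x ∉ Ω₀ → lam x = 0) (h0 : ∀ x ∈ Λs 0, lam x = 0)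
    (hQ : ∀ j, 1 ≤ j → j ≤ m → ∀ y ∈ Λs j, ∑ x ∈ blockSites (L ^ j) y, lam x = 0) :
    ∑ᶠ x, covLap η (1 : B7Prop1Explicit.Site d → Fin d → ℂˣ) lam x *
        Ω₀.indicator (covDivB η (1 : B7Prop1Explicit.Site d → Fin d → ℂˣ) (fun z κ => φ (A' z κ))) x = 0 :=
  pairing_covLap_eq_zero_of_isLandau138 hL hΩ (isLandau138_map_flat φ h) hsupp h0 hQ

end Zd

/-! ## §2  The cover transport of the flat stencils: scalar test functions and the pushed-down potential -/

section Cover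

variable {P : Params}

/-- `(y + e_ν) − e_ν = y` on the torus (local; `Setup`'s lemma of this name is private to `LatticeFieldCalculus`). [folklore] -/
private theorem shift_unshift_self (y : Site P 0) (ν : Fin P.d) : (y.shift ν).unshift ν = y := by
  funext i
  by_cases hi : i = ν
  · subst hi; simp [Site.shift, Site.unshift]
  · simp [Site.shift, Site.unshift, hi]

/-- `(y − e_ν) + e_ν = y` on the torus (local). [folklore] -/
private theorem unshift_shift_self (y : Site P 0) (ν : Fin P.d) : (y.unshift ν).shift ν = y := by
  funext i
  by_cases hi : i = ν
  · subst hi; simp [Site.shift, Site.unshift]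
  · simp [Site.shift, Site.unshift, hi]

/-- **THE FLAT LAPLACIAN UNDER THE COVER**: for a `ℤᵈ` function `λ` that is the pull-back `μ ∘ π` on the window `X`, at `x` with `x, x ± e_ν ∈ X`, lit-balaban's
`(Δ^η_1λ)(x)` ([4] (3.23) at `U₀ = 1`) IS pub-balaban's torus Laplacian `(laplace η⁻¹ μ)(π x) = Σ_ν η⁻²(2μ(πx) − μ(πx + e_ν) − μ(πx − e_ν))` ([B5] (1.21)).
[cite: Balaban1985BackgroundPropagators, (3.23) p.394; Balaban1984PropagatorsI, (1.21) p.21 (bookkeeping under the cover)] -/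
theorem covLap_one_eq_laplace_cover (η : ℝ) {X : Set (Pt P.d)} {μ : Site P 0 → ℂ} {lam : Pt P.d → ℂ}
    (hlam : ∀ z, z ∈ X → lam z = μ (cover P z)) {x : Pt P.d} (hx : x ∈ X) (hν : ∀ ν, x + e ν ∈ X ∧ x - e ν ∈ X) :
    covLap η (1 : B7Prop1Explicit.Site P.d → Fin P.d → ℂˣ) lam x = laplace η⁻¹ μ (cover P x) := by
  rw [covLap_one_apply]
  unfold laplace
  refine Finset.sum_congr rfl fun ν _ => ?_
  obtain ⟨h1, h2⟩ := hν ν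
  rw [hlam _ hx, hlam _ h1, hlam _ h2, cover_add_e, cover_sub_e, ← smul_sub, smul_smul, ← pow_two]
  congr 1
  abel

variable {𝔸 : Type*} [NormedRing 𝔸] [NormedAlgebra ℂ 𝔸]

/-- **THE FLAT DIVERGENCE UNDER THE COVER**: for a torus potential `A` that is the push-forward of `A′` on the window `X` (`A ⟨π z, κ⟩ = A′ z κ`), at `x` with
`x, x − e_κ ∈ X`, lit-balaban's `(D^{η*}_1A′)(x) = Σ_κ η⁻¹(A′(x − e_κ, κ) − A′(x, κ))` ([6] (1.1) at `U₀ = 1`) IS pub-balaban's torus divergence `(diverg η⁻¹ A)(π x)`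
([B5] (1.21)). [cite: Balaban1985RegularSpaces, (1.1) p.76, (1.38) p.82; Balaban1984PropagatorsI, (1.21) p.21 (bookkeeping under the cover)] -/
theorem covDivB_one_eq_diverg_cover (η : ℝ) {X : Set (Pt P.d)} {A : PBond P 0 → 𝔸} {A' : Pt P.d → Fin P.d → 𝔸}
    (hA : ∀ z, z ∈ X → ∀ κ, A ⟨cover P z, κ⟩ = A' z κ) {x : Pt P.d} (hx : x ∈ X) (hκ : ∀ κ, x - e κ ∈ X) :
    covDivB η (1 : B7Prop1Explicit.Site P.d → Fin P.d → 𝔸ˣ) A' x = diverg η⁻¹ A (cover P x) := by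
  unfold covDivB diverg
  refine Finset.sum_congr rfl fun κ _ => ?_
  rw [covDeriv_one_apply, ← hA _ hx, ← hA _ (hκ κ), cover_sub_e]

/-- **A `ℤᵈ` SUM OVER A COVER-INJECTIVE FINITE SET IS THE TORUS SUM**: if `g` vanishes off the finite `X₁ ⊆ ℤᵈ`, `π` is injective on `X₁`, `G(π x) = g(x)` on `X₁` and
`G` vanishes off `π(X₁)`, then `Σ_{y ∈ T} G(y) = Σ_x g(x)`. [cite: Balaban1988Convergent, p.257 (bookkeeping under the cover)] -/
theorem sum_eq_finsum_cover {X₁ : Finset (Pt P.d)} (hinj : Set.InjOn (cover P) ↑X₁) {g : Pt P.d → ℂ} {G : Site P 0 → ℂ}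
    (hg : ∀ x, x ∉ X₁ → g x = 0) (hG : ∀ x ∈ X₁, G (cover P x) = g x) (hG0 : ∀ y, y ∉ X₁.image (cover P) → G y = 0) :
    ∑ y : Site P 0, G y = ∑ᶠ x, g x := by
  classical
  rw [finsum_eq_sum_of_support_subset g (s := X₁) (fun x hx => by by_contra h'; exact hx (hg x h'))]
  rw [← Finset.sum_subset (Finset.subset_univ (X₁.image (cover P))) (fun y _ hy => hG0 y hy)]
  rw [Finset.sum_image (fun x hx x' hx' h => hinj hx hx' h)]
  exact Finset.sum_congr rfl hG

end Cover

/-! ## §3  ★★ (153) AT THE RECORD'S TORUS, TEST-FUNCTION FORM: `Σ_y (Δμ)(y)·φ((∂*A)(y)) = 0` for the pushed-down potential -/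

section Main

variable {P : Params}
variable {𝔸 : Type*} [NormedRing 𝔸] [NormedAlgebra ℂ 𝔸] [CompleteSpace 𝔸]

/-- ★★ **[15] (153) ∕ [6] (1.38) ∕ [B6] (2.12) «R ∂^{η*}A = 0» AT THE TORUS OF RECORD, TEST-FUNCTION FORM.**  Let `A′` on `ℤᵈ` satisfy the flat multiplier form
`IsLandau138 L m η Ω₀ Λs 1 A′` on the finite Dirichlet domain `Ω₀` ([4] (3.24) «↾Ω₀») with the constraint tower `Λs`; let `X ⊆ Ω₀` be a window on which the cover `π` is
injective and on which the torus potential `A` is the push-forward of `A′` (`A ⟨π z, κ⟩ = A′ z κ`).  Then for every torus test function `μ : T → ℂ` whose support lifts to a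
set `S` lying TWO steps inside `X` (`hμS`, `hS`), which vanishes on the lift of `Λ₀` inside `X` (`h0`) and whose lift `𝟙_X·(μ∘π)` has vanishing `Lʲ`-block sums on the
blocks of `Λ_j`, `1 ≤ j ≤ m` (`hQ`) — the rows of `μ ∈ N(Q′)` ([B6] (2.7)) read through the cover — and every `φ : 𝔸 →L[ℂ] ℂ`:
`Σ_{y ∈ T} (laplace η⁻¹ μ)(y) · φ((diverg η⁻¹ A)(y)) = 0`, i.e. `⟨Δμ, ∂*(φ∘A)⟩ = 0` — the reading of `R ∂*A = 0` on test functions (`B6SectAOperatorsV1.RE_eq_zero_iff`).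
Proof: n05-c's `ℤᵈ` identity for `λ := 𝟙_X·(μ∘π)` and `φ ∘ A′` (§1), whose finitely supported sum is transported term by term through the cover (§2): the Laplacian of
`λ` is supported one step around `S`, where all stencils stay inside `X`. [cite: Balaban1985Variational, (153) p.301, p.302; Balaban1985RegularSpaces, (1.38) p.82, p.80; Balaban1984PropagatorsII, (2.7) p.224, (2.10)–(2.12) p.225; Balaban1985BackgroundPropagators, (3.23)–(3.25) p.394] -/
theorem sum_laplace_mul_diverg_eq_zero_of_isLandau138_cover {L m : ℕ} (hL : 1 ≤ L) {η : ℝ} {Ω₀ : Set (Pt P.d)} (hΩ : Ω₀.Finite)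
    {Λs : ℕ → Set (Pt P.d)} {A' : Pt P.d → Fin P.d → 𝔸}
    (hLan : IsLandau138 L m η Ω₀ Λs (1 : B7Prop1Explicit.Site P.d → Fin P.d → 𝔸ˣ) A')
    {X : Set (Pt P.d)} (hXΩ : X ⊆ Ω₀) (hinj : Set.InjOn (cover P) X)
    {A : PBond P 0 → 𝔸} (hA : ∀ z, z ∈ X → ∀ κ, A ⟨cover P z, κ⟩ = A' z κ)
    {μ : Site P 0 → ℂ} {S : Set (Pt P.d)} (hμS : ∀ y, μ y ≠ 0 → y ∈ cover P '' S)
    (hS : ∀ s ∈ S, ∀ z : Pt P.d, (∀ i, |z i - s i| ≤ 2) → z ∈ X)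
    (h0 : ∀ x ∈ X, x ∈ Λs 0 → μ (cover P x) = 0)
    (hQ : ∀ j, 1 ≤ j → j ≤ m → ∀ y ∈ Λs j, ∑ x ∈ blockSites (L ^ j) y, X.indicator (fun z => μ (cover P z)) x = 0)
    (φ : 𝔸 →L[ℂ] ℂ) :
    ∑ y : Site P 0, laplace η⁻¹ μ y * φ (diverg η⁻¹ A y) = 0 := by
  classical
  set lam : Pt P.d → ℂ := X.indicator (fun z => μ (cover P z)) with hlamdef
  have hlamX : ∀ z, z ∈ X → lam z = μ (cover P z) := fun z hz => by rw [hlamdef, Set.indicator_of_mem hz]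
  have hlam0 : ∀ z, z ∉ X → lam z = 0 := fun z hz => by rw [hlamdef, Set.indicator_of_notMem hz]
  -- the ℤᵈ identity (§1)
  have key := pairing_covLap_map_eq_zero_of_isLandau138 hL hΩ hLan φ (lam := lam)
    (fun x hx => hlam0 x fun h => hx (hXΩ h))
    (fun x hx => by
      by_cases hxX : x ∈ X
      · rw [hlamX x hxX]; exact h0 x hxX hx
      · exact hlam0 x hxX)
    hQ
  rw [← key]
  -- geometry of the sup-ball: the stencil points of a point within distance 1 of `s ∈ S` are within distance 2 of `s`, hence in `X`
  have habs_e : ∀ (ν i : Fin P.d), |(e ν : Pt P.d) i| ≤ 1 := fun ν i => by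
    rw [e_apply]; split_ifs <;> simp
  have hself : ∀ z : Pt P.d, ∀ i, |z i - z i| ≤ 1 := fun z i => by simp
  have hadd : ∀ (z : Pt P.d) (ν i : Fin P.d), |(z + e ν) i - z i| ≤ 1 := fun z ν i => by
    simp only [Pi.add_apply, add_sub_cancel_left]; exact habs_e ν i
  have hsub : ∀ (z : Pt P.d) (ν i : Fin P.d), |(z - e ν) i - z i| ≤ 1 := fun z ν i => by
    simp only [Pi.sub_apply, sub_sub_cancel_left, abs_neg]; exact habs_e ν i
  have hball : ∀ s ∈ S, ∀ z : Pt P.d, (∀ i, |z i - s i| ≤ 1) → z ∈ X ∧ ∀ ν, z + e ν ∈ X ∧ z - e ν ∈ X := by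
    intro s hs z hz
    have h2 : ∀ w : Pt P.d, (∀ i, |w i - z i| ≤ 1) → w ∈ X := fun w hw =>
      hS s hs w fun i => by
        have := abs_sub_le (w i) (z i) (s i)
        linarith [hw i, hz i]
    exact ⟨h2 z (hself z), fun ν => ⟨h2 _ (hadd z ν), h2 _ (hsub z ν)⟩⟩
  -- the finite set carrying the Laplacian of `λ`: the points of `Ω₀` within sup-distance 1 of `S`
  set X₁ : Finset (Pt P.d) := hΩ.toFinset.filter (fun z => ∃ s ∈ S, ∀ i, |z i - s i| ≤ 1) with hX₁def
  have hmemX₁ : ∀ z, z ∈ X₁ ↔ z ∈ Ω₀ ∧ ∃ s ∈ S, ∀ i, |z i - s i| ≤ 1 := fun z => by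
    rw [hX₁def, Finset.mem_filter, Set.Finite.mem_toFinset]
  have hX₁_of_near : ∀ s ∈ S, ∀ z : Pt P.d, (∀ i, |z i - s i| ≤ 1) → z ∈ X₁ := fun s hs z hz =>
    (hmemX₁ z).2 ⟨hXΩ (hball s hs z hz).1, s, hs, hz⟩
  have hX₁X : ∀ z, z ∈ X₁ → z ∈ X := fun z hz => by
    obtain ⟨-, s, hs, hzs⟩ := (hmemX₁ z).1 hz
    exact (hball s hs z hzs).1
  -- `λ ≠ 0` only on `S` (cover-injectivity on `X`)
  have hlam_ne : ∀ z, lam z ≠ 0 → z ∈ S := by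
    intro z hz
    have hzX : z ∈ X := by by_contra h; exact hz (hlam0 z h)
    rw [hlamX z hzX] at hz
    obtain ⟨s, hs, hsz⟩ := hμS _ hz
    have hsX : s ∈ X := (hball s hs s (hself s)).1
    rwa [← hinj hsX hzX hsz]
  refine sum_eq_finsum_cover (X₁ := X₁) (fun x hx x' hx' h => hinj (hX₁X x hx) (hX₁X x' hx') h) ?_ ?_ ?_
  · -- off `X₁` the Laplacian of `λ` vanishes
    intro x hx
    have hz0 : ∀ w : Pt P.d, (∀ i, |x i - w i| ≤ 1) → lam w = 0 := fun w hw => by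
      by_contra h; exact hx (hX₁_of_near w (hlam_ne w h) x hw)
    have hx0 : lam x = 0 := hz0 x (hself x)
    have hx1 : ∀ ν, lam (x + e ν) = 0 := fun ν => hz0 _ fun i => by
      simp only [Pi.add_apply, sub_add_cancel_left, abs_neg]; exact habs_e ν i
    have hx2 : ∀ ν, lam (x - e ν) = 0 := fun ν => hz0 _ fun i => by
      simp only [Pi.sub_apply, sub_sub_cancel]; exact habs_e ν i
    rw [covLap_one_apply]
    simp only [hx0, hx1, hx2, sub_self, smul_zero, Finset.sum_const_zero, zero_mul]
  · -- on `X₁` the two summands agree term by term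
    intro x hx
    obtain ⟨hxΩ, s, hs, hxs⟩ := (hmemX₁ x).1 hx
    obtain ⟨hxX, hν⟩ := hball s hs x hxs
    rw [covLap_one_eq_laplace_cover η hlamX hxX hν, Set.indicator_of_mem hxΩ, ← map_covDivB_flat φ,
      covDivB_one_eq_diverg_cover η hA hxX fun κ => (hν κ).2]
  · -- off `π(X₁)` the torus Laplacian of `μ` vanishes
    intro y hy
    have himg : ∀ z, z ∈ X₁ → cover P z = y → False := fun z hz hzy => hy (Finset.mem_image.2 ⟨z, hz, hzy⟩)
    have hy0 : μ y = 0 := by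
      by_contra h
      obtain ⟨s, hs, hsy⟩ := hμS y h
      exact himg s (hX₁_of_near s hs s (hself s)) hsy
    have hy1 : ∀ ν, μ (y.shift ν) = 0 := fun ν => by
      by_contra h
      obtain ⟨s, hs, hsy⟩ := hμS _ h
      refine himg (s - e ν) (hX₁_of_near s hs _ (hsub s ν)) ?_
      rw [cover_sub_e, hsy, shift_unshift_self]
    have hy2 : ∀ ν, μ (y.unshift ν) = 0 := fun ν => by
      by_contra h
      obtain ⟨s, hs, hsy⟩ := hμS _ h
      refine himg (s + e ν) (hX₁_of_near s hs _ (hadd s ν)) ?_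
      rw [cover_add_e, hsy, unshift_shift_self]
    have hlap : laplace η⁻¹ μ y = 0 := by
      unfold laplace
      simp only [hy0, hy1, hy2, add_zero, sub_self, smul_zero, Finset.sum_const_zero]
    rw [hlap, zero_mul]

/-- ★ **THE REAL FORM, REAL PART** (k0-s1-w1's entrywise currency): for a REAL torus test function `μ : T → ℝ` with the rows of §3 and every `φ : 𝔸 →L[ℂ] ℂ`, the real
bond function `a := Re(φ ∘ A)` satisfies `Σ_y (laplace η⁻¹ μ)(y)·(diverg η⁻¹ a)(y) = 0` — `⟨Δμ, ∂*a⟩ = 0` in the `ℓ²` pairing of `B6SectAOperatorsV1.inner_eq_sum`.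
[cite: Balaban1985Variational, (153) p.301; Balaban1984PropagatorsII, (2.8) p.224, (2.12) p.225] -/
theorem sum_laplace_mul_diverg_re_eq_zero_of_isLandau138_cover {L m : ℕ} (hL : 1 ≤ L) {η : ℝ} {Ω₀ : Set (Pt P.d)} (hΩ : Ω₀.Finite)
    {Λs : ℕ → Set (Pt P.d)} {A' : Pt P.d → Fin P.d → 𝔸}
    (hLan : IsLandau138 L m η Ω₀ Λs (1 : B7Prop1Explicit.Site P.d → Fin P.d → 𝔸ˣ) A')
    {X : Set (Pt P.d)} (hXΩ : X ⊆ Ω₀) (hinj : Set.InjOn (cover P) X)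
    {A : PBond P 0 → 𝔸} (hA : ∀ z, z ∈ X → ∀ κ, A ⟨cover P z, κ⟩ = A' z κ)
    {μ : Site P 0 → ℝ} {S : Set (Pt P.d)} (hμS : ∀ y, μ y ≠ 0 → y ∈ cover P '' S)
    (hS : ∀ s ∈ S, ∀ z : Pt P.d, (∀ i, |z i - s i| ≤ 2) → z ∈ X)
    (h0 : ∀ x ∈ X, x ∈ Λs 0 → μ (cover P x) = 0)
    (hQ : ∀ j, 1 ≤ j → j ≤ m → ∀ y ∈ Λs j, ∑ x ∈ blockSites (L ^ j) y, X.indicator (fun z => μ (cover P z)) x = 0)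
    (φ : 𝔸 →L[ℂ] ℂ) :
    ∑ y : Site P 0, laplace η⁻¹ μ y * diverg η⁻¹ (fun b => (φ (A b)).re) y = 0 := by
  have hC := sum_laplace_mul_diverg_eq_zero_of_isLandau138_cover hL hΩ hLan hXΩ hinj hA (μ := fun y => (μ y : ℂ)) (S := S)
    (fun y hy => hμS y (by simpa using hy)) hS (fun x hx hx0 => by simp [h0 x hx hx0])
    (fun j hj hjm y hy => by
      have := hQ j hj hjm y hy
      have hind : ∀ x, X.indicator (fun z => ((μ (cover P z) : ℝ) : ℂ)) x = ((X.indicator (fun z => μ (cover P z)) x : ℝ) : ℂ) := fun x => by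
        by_cases hx : x ∈ X
        · rw [Set.indicator_of_mem hx, Set.indicator_of_mem hx]
        · rw [Set.indicator_of_notMem hx, Set.indicator_of_notMem hx, Complex.ofReal_zero]
      simp_rw [hind, ← Complex.ofReal_sum, this, Complex.ofReal_zero]) φ
  -- real Laplacian of a real function, cast; real part of `φ ∘ diverg`
  have hlap : ∀ y, laplace η⁻¹ (fun y => (μ y : ℂ)) y = ((laplace η⁻¹ μ y : ℝ) : ℂ) := fun y => by
    simp only [laplace, smul_eq_mul, Complex.real_smul, Complex.ofReal_sum, Complex.ofReal_mul, Complex.ofReal_pow, Complex.ofReal_inv,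
      Complex.ofReal_sub, Complex.ofReal_add]
  have hdiv : ∀ y, (φ (diverg η⁻¹ A y)).re = diverg η⁻¹ (fun b => (φ (A b)).re) y := fun y => by
    simp only [diverg, map_sum, φ.map_smul_of_tower, map_sub, Complex.re_sum, Complex.smul_re, Complex.sub_re]
  simp_rw [hlap] at hC
  have := congrArg Complex.re hC
  rw [Complex.re_sum, Complex.zero_re] at this
  simpa only [Complex.re_ofReal_mul, hdiv] using this

/-- ★ **THE REAL FORM, IMAGINARY PART**: the same for `a := Im(φ ∘ A)`. [cite: Balaban1985Variational, (153) p.301; Balaban1984PropagatorsII, (2.8) p.224, (2.12) p.225] -/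
theorem sum_laplace_mul_diverg_im_eq_zero_of_isLandau138_cover {L m : ℕ} (hL : 1 ≤ L) {η : ℝ} {Ω₀ : Set (Pt P.d)} (hΩ : Ω₀.Finite)
    {Λs : ℕ → Set (Pt P.d)} {A' : Pt P.d → Fin P.d → 𝔸}
    (hLan : IsLandau138 L m η Ω₀ Λs (1 : B7Prop1Explicit.Site P.d → Fin P.d → 𝔸ˣ) A')
    {X : Set (Pt P.d)} (hXΩ : X ⊆ Ω₀) (hinj : Set.InjOn (cover P) X)
    {A : PBond P 0 → 𝔸} (hA : ∀ z, z ∈ X → ∀ κ, A ⟨cover P z, κ⟩ = A' z κ)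
    {μ : Site P 0 → ℝ} {S : Set (Pt P.d)} (hμS : ∀ y, μ y ≠ 0 → y ∈ cover P '' S)
    (hS : ∀ s ∈ S, ∀ z : Pt P.d, (∀ i, |z i - s i| ≤ 2) → z ∈ X)
    (h0 : ∀ x ∈ X, x ∈ Λs 0 → μ (cover P x) = 0)
    (hQ : ∀ j, 1 ≤ j → j ≤ m → ∀ y ∈ Λs j, ∑ x ∈ blockSites (L ^ j) y, X.indicator (fun z => μ (cover P z)) x = 0)
    (φ : 𝔸 →L[ℂ] ℂ) :
    ∑ y : Site P 0, laplace η⁻¹ μ y * diverg η⁻¹ (fun b => (φ (A b)).im) y = 0 := by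
  have hC := sum_laplace_mul_diverg_eq_zero_of_isLandau138_cover hL hΩ hLan hXΩ hinj hA (μ := fun y => (μ y : ℂ)) (S := S)
    (fun y hy => hμS y (by simpa using hy)) hS (fun x hx hx0 => by simp [h0 x hx hx0])
    (fun j hj hjm y hy => by
      have := hQ j hj hjm y hy
      have hind : ∀ x, X.indicator (fun z => ((μ (cover P z) : ℝ) : ℂ)) x = ((X.indicator (fun z => μ (cover P z)) x : ℝ) : ℂ) := fun x => by
        by_cases hx : x ∈ X
        · rw [Set.indicator_of_mem hx, Set.indicator_of_mem hx]
        · rw [Set.indicator_of_notMem hx, Set.indicator_of_notMem hx, Complex.ofReal_zero]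
      simp_rw [hind, ← Complex.ofReal_sum, this, Complex.ofReal_zero]) φ
  have hlap : ∀ y, laplace η⁻¹ (fun y => (μ y : ℂ)) y = ((laplace η⁻¹ μ y : ℝ) : ℂ) := fun y => by
    simp only [laplace, smul_eq_mul, Complex.real_smul, Complex.ofReal_sum, Complex.ofReal_mul, Complex.ofReal_pow, Complex.ofReal_inv,
      Complex.ofReal_sub, Complex.ofReal_add]
  have hdiv : ∀ y, (φ (diverg η⁻¹ A y)).im = diverg η⁻¹ (fun b => (φ (A b)).im) y := fun y => by
    simp only [diverg, map_sum, φ.map_smul_of_tower, map_sub, Complex.im_sum, Complex.smul_im, Complex.sub_im]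
  simp_rw [hlap] at hC
  have := congrArg Complex.im hC
  rw [Complex.im_sum, Complex.zero_im] at this
  simpa only [Complex.im_ofReal_mul, hdiv] using this

end Main
/-! ## §4  ★ The same, keyed on the sixth conjunct of generation 0's window ∕ cube theorems at a `CubeB8` datum -/

section Window

variable {P : Params} {N : ℕ}

/-- `□ ⊆ □₀`: the grid box of a `CubeB8` datum lies in the largest cube of its tower (1.131) (`box_subset_cube`, `cubeFam_false_zero`). [cite: Balaban1985RegularSpaces, (1.131) p.99] -/
theorem box_subset_sq_zero {L K' : ℕ} {Ω' : ℕ → Set (B7Prop1Explicit.Site d)} (c : CubeB8 d L K' Ω') :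
    box L c.a c.M c.k ⊆ c.sq 0 :=
  (B8Eq131Cubes.box_subset_cube (Nat.zero_le _)).trans (cubeFam_false_zero L c.a c.M c.ρ c.k).symm.subset

/-- ★ **(153) AT THE RECORD'S TORUS, TEST-FUNCTION FORM, FROM THE SIXTH CONJUNCT OF THE PUSH-DOWN** (`Node00.TorusCoverLandau153Print`'s
`exists_localGauge152_153_window_of_gaugedBoundB8` ∕ `Node00.TorusCoverLandau153`'s `exists_localGauge152_153_cube_of_prop6` ∕ the print-datum editions): at a `CubeB8`
datum `c` (tower `□₀ = c.sq 0 ⊇ … ⊇ □_k ⊇ □ = box`, layers `c.lamS`), for a cover-injective window `X ⊆ □` and a torus potential `A : PBond P 0 → M_N(ℂ)` with «`∃ A′`,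
`A ⟨π x, μ⟩ = A′ x μ` on `X` ∧ `IsLandau138 L c.k η □₀ c.lamS 1 A′`» (the sixth conjunct, LITERALLY), every torus test function `μ` with the rows of §3 (support two steps
inside `X`; zero on the lift of `Λ′₀`; zero lifted `Lʲ`-block sums on the blocks of `Λ′_j`, `1 ≤ j ≤ k`) and every `φ : M_N(ℂ) →L[ℂ] ℂ` (the matrix entries) give
`Σ_y (laplace η⁻¹ μ)(y)·φ((diverg η⁻¹ A)(y)) = 0`.  A consumer writes `obtain ⟨u, A, h₁, h₂, h₃, h₄, h₅, h₆⟩ := exists_localGauge152_153_window_of_gaugedBoundB8 …` and feeds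
`h₆` here. [cite: Balaban1985Variational, (152)–(153) p.301; Balaban1985RegularSpaces, Prop. 6 (1.135)–(1.138) p.99, (1.38) p.82; Balaban1984PropagatorsII, (2.12) p.225] -/
theorem sum_laplace_mul_diverg_eq_zero_of_window153 {K' : ℕ} {Ω' : ℕ → Set (B7Prop1Explicit.Site P.d)} (c : CubeB8 P.d P.L K' Ω')
    {η : ℝ} {X : Set (Pt P.d)} (hbox : X ⊆ box P.L c.a c.M c.k) (hinj : Set.InjOn (cover P) X)
    {A : PBond P 0 → MatA N}
    (h6 : ∃ A' : B7Prop1Explicit.Site P.d → Fin P.d → MatA N,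
        (∀ x, x ∈ X → ∀ μ, A ⟨cover P x, μ⟩ = A' x μ) ∧
        IsLandau138 P.L c.k η (c.sq 0) c.lamS (1 : B7Prop1Explicit.Site P.d → Fin P.d → (MatA N)ˣ) A')
    {μ : Site P 0 → ℂ} {S : Set (Pt P.d)} (hμS : ∀ y, μ y ≠ 0 → y ∈ cover P '' S)
    (hS : ∀ s ∈ S, ∀ z : Pt P.d, (∀ i, |z i - s i| ≤ 2) → z ∈ X)
    (h0 : ∀ x ∈ X, x ∈ c.lamS 0 → μ (cover P x) = 0)
    (hQ : ∀ j, 1 ≤ j → j ≤ c.k → ∀ y ∈ c.lamS j, ∑ x ∈ blockSites (P.L ^ j) y, X.indicator (fun z => μ (cover P z)) x = 0)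
    (φ : MatA N →L[ℂ] ℂ) :
    ∑ y : Site P 0, laplace η⁻¹ μ y * φ (diverg η⁻¹ A y) = 0 := by
  obtain ⟨A', hA, hLan⟩ := h6
  exact sum_laplace_mul_diverg_eq_zero_of_isLandau138_cover P.L_pos (cubeFam_zero_finite P.L c.a c.M c.ρ c.k) hLan
    (hbox.trans (box_subset_sq_zero c)) hinj hA hμS hS h0 hQ φ

/-- ★ **The same, REAL test function, REAL PART of the entry** (`a := Re(φ∘A)`: `Σ_y (Δμ)(y)·(∂*a)(y) = 0` = `⟨Δμ, ∂*a⟩ = 0`, the pairing of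
`B6SectAOperatorsV1.RE_eq_zero_iff`). [cite: Balaban1985Variational, (153) p.301; Balaban1984PropagatorsII, (2.8) p.224, (2.12) p.225] -/
theorem sum_laplace_mul_diverg_re_eq_zero_of_window153 {K' : ℕ} {Ω' : ℕ → Set (B7Prop1Explicit.Site P.d)} (c : CubeB8 P.d P.L K' Ω')
    {η : ℝ} {X : Set (Pt P.d)} (hbox : X ⊆ box P.L c.a c.M c.k) (hinj : Set.InjOn (cover P) X)
    {A : PBond P 0 → MatA N}
    (h6 : ∃ A' : B7Prop1Explicit.Site P.d → Fin P.d → MatA N,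
        (∀ x, x ∈ X → ∀ μ, A ⟨cover P x, μ⟩ = A' x μ) ∧
        IsLandau138 P.L c.k η (c.sq 0) c.lamS (1 : B7Prop1Explicit.Site P.d → Fin P.d → (MatA N)ˣ) A')
    {μ : Site P 0 → ℝ} {S : Set (Pt P.d)} (hμS : ∀ y, μ y ≠ 0 → y ∈ cover P '' S)
    (hS : ∀ s ∈ S, ∀ z : Pt P.d, (∀ i, |z i - s i| ≤ 2) → z ∈ X)
    (h0 : ∀ x ∈ X, x ∈ c.lamS 0 → μ (cover P x) = 0)
    (hQ : ∀ j, 1 ≤ j → j ≤ c.k → ∀ y ∈ c.lamS j, ∑ x ∈ blockSites (P.L ^ j) y, X.indicator (fun z => μ (cover P z)) x = 0)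
    (φ : MatA N →L[ℂ] ℂ) :
    ∑ y : Site P 0, laplace η⁻¹ μ y * diverg η⁻¹ (fun b => (φ (A b)).re) y = 0 := by
  obtain ⟨A', hA, hLan⟩ := h6
  exact sum_laplace_mul_diverg_re_eq_zero_of_isLandau138_cover P.L_pos (cubeFam_zero_finite P.L c.a c.M c.ρ c.k) hLan
    (hbox.trans (box_subset_sq_zero c)) hinj hA hμS hS h0 hQ φ

/-- ★ **The same, REAL test function, IMAGINARY PART of the entry** (`a := Im(φ∘A)`). [cite: Balaban1985Variational, (153) p.301; Balaban1984PropagatorsII, (2.8) p.224, (2.12) p.225] -/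
theorem sum_laplace_mul_diverg_im_eq_zero_of_window153 {K' : ℕ} {Ω' : ℕ → Set (B7Prop1Explicit.Site P.d)} (c : CubeB8 P.d P.L K' Ω')
    {η : ℝ} {X : Set (Pt P.d)} (hbox : X ⊆ box P.L c.a c.M c.k) (hinj : Set.InjOn (cover P) X)
    {A : PBond P 0 → MatA N}
    (h6 : ∃ A' : B7Prop1Explicit.Site P.d → Fin P.d → MatA N,
        (∀ x, x ∈ X → ∀ μ, A ⟨cover P x, μ⟩ = A' x μ) ∧
        IsLandau138 P.L c.k η (c.sq 0) c.lamS (1 : B7Prop1Explicit.Site P.d → Fin P.d → (MatA N)ˣ) A')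
    {μ : Site P 0 → ℝ} {S : Set (Pt P.d)} (hμS : ∀ y, μ y ≠ 0 → y ∈ cover P '' S)
    (hS : ∀ s ∈ S, ∀ z : Pt P.d, (∀ i, |z i - s i| ≤ 2) → z ∈ X)
    (h0 : ∀ x ∈ X, x ∈ c.lamS 0 → μ (cover P x) = 0)
    (hQ : ∀ j, 1 ≤ j → j ≤ c.k → ∀ y ∈ c.lamS j, ∑ x ∈ blockSites (P.L ^ j) y, X.indicator (fun z => μ (cover P z)) x = 0)
    (φ : MatA N →L[ℂ] ℂ) :
    ∑ y : Site P 0, laplace η⁻¹ μ y * diverg η⁻¹ (fun b => (φ (A b)).im) y = 0 := by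
  obtain ⟨A', hA, hLan⟩ := h6
  exact sum_laplace_mul_diverg_im_eq_zero_of_isLandau138_cover P.L_pos (cubeFam_zero_finite P.L c.a c.M c.ρ c.k) hLan
    (hbox.trans (box_subset_sq_zero c)) hinj hA hμS hS h0 hQ φ

end Window

end Literature.MathematicalPhysics.QuantumFieldTheory.Balaban1983to89.Node00

end
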